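import Mathlib
import Literature.Computability.AlgebraicComplexity.BorderRankRestriction

/-!
# Stub `stub_borderRank_smul` for line `Sketch` of crux `FixedPointFreeTargets`
(stmt-MatrixMultiplication-15042)

Bläser's `K[ε]`-border rank `algBorderRank` (`SchoenhageTau.lean`) is invariant under non-zero
scalars: `bR (c • t) = bR t` for `c ≠ 0` in a field.  A scalar multiple `c • t` is the restriction
of `t` by the matrices `(c · 1, 1, 1)`, so `bR (c • t) ≤ bR t` by restriction monotonicity
(`algBorderRank_restrict₁_le`, `BorderRankRestriction.lean`); applied to `c • t` and `c⁻¹` this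
also gives `bR t = bR (c⁻¹ • (c • t)) ≤ bR (c • t)`.
-/

set_option linter.dupNamespace false

noncomputable section

namespace Summit.MatrixMultiplication.MatrixMultiplication.Theorems

open scoped BigOperators
open Literature.Computability.AlgebraicComplexity

namespace PauliTautologicalTarget

/-- A scalar multiple `c • t` is the restriction of `t` by `(c · 1, 1, 1)` in the first factor, so
`bR (c • t) ≤ bR t` (any commutative semiring, any scalar). -/
theorem algBorderRank_smul_le {K : Type*} [CommSemiring K] {ι κ μ : Type*} [Fintype ι]
    [Fintype κ] [Fintype μ] [DecidableEq ι] [DecidableEq κ] [DecidableEq μ] (c : K)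
    (t : ι → κ → μ → K) : algBorderRank (c • t) ≤ algBorderRank t := by
  have h : c • t = fun a' b d => ∑ a, (if a = a' then c else 0) * t a b d := by
    funext a' b d
    simp only [Pi.smul_apply, smul_eq_mul, ite_mul, zero_mul, Finset.sum_ite_eq',
      Finset.mem_univ, if_true]
  rw [h]
  exact algBorderRank_restrict₁_le t (fun a' a => if a = a' then c else 0)

/-- Border rank is invariant under non-zero scalars (restriction monotonicity both ways). -/
theorem stub_borderRank_smul {K : Type*} [Field K] {ι κ μ : Type*} [Fintype ι] [Fintype κ]
    [Fintype μ] [DecidableEq ι] [DecidableEq κ] [DecidableEq μ] (c : K) (hc : c ≠ 0)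
    (t : ι → κ → μ → K) : algBorderRank (c • t) = algBorderRank t := by
  refine le_antisymm (algBorderRank_smul_le c t) ?_
  have h := algBorderRank_smul_le c⁻¹ (c • t)
  rwa [inv_smul_smul₀ hc] at h

end PauliTautologicalTarget

end Summit.MatrixMultiplication.MatrixMultiplication.Theorems

end
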